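import Summits.ResolutionOfSingularities.ResolutionOfSingularities.Theorems.FrobeniusClosingPatchingRelPerfectCoreRungTowerHypersurface
import HarnessLib

/-!
# Crux `PatchingRelPerfect` (stmt-ResolutionOfSingularities-16161), chain w52 — rung toolkit:
# weakly regular PAIRS of non-zero-divisors may be swapped and perturbed (three-letter step, brick 5)

[OURS · L1 W5.2 · rung tool] Two small facts the contact-migration towers use to feed the
three-letter step (`…ThreeLetterStep.lean`) with its quasi-regular pairs when the hyperplane letter is
only CONGRUENT to a chart generator (`c = u' + w G ≡ u' (mod w)`, this seat's hand note §2):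

* `isSMulRegular_quot_span_congr` — regularity of `b` on `A/(a)` only depends on `b` modulo `a`;
* `isWeaklyRegular_pair_of_add_mul` — `[a, b]` weakly regular ⇒ `[a, b + a m]` weakly regular;
* `isWeaklyRegular_pair_swap` — for non-zero-divisors `a, b` of a commutative ring, `[a, b]` weakly
  regular ⇒ `[b, a]` weakly regular (`a y ∈ (b) ⇒ y ∈ (b)` from `b x ∈ (a) ⇒ x ∈ (a)`);
* `isQuasiRegular_pair_swap`, `isQuasiRegular_pair_of_add_mul` — the quasi-regular consequences
  (Matsumura 16.2 (i)).

Arbitrary commutative rings; nothing here is a statement of the manuscript under review.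

## References

* H. Matsumura, *Commutative Ring Theory*, CUP 1986, Thm. 16.2 (i). [Matsumura1987]
-/

-- `Summit.<Summit>.<Sub>.Theorems` with `Sub = Summit` (single-conjunct summit, D-0017)
set_option linter.dupNamespace false

noncomputable section

open Literature.AlgebraicGeometry.Resolution
open scoped Pointwise

namespace Summit.ResolutionOfSingularities.ResolutionOfSingularities.Theorems

namespace ConeRung

universe u

variable {A : Type u} [CommRing A]

/-- A weakly regular pair, unfolded: `a` is regular on `A` and `b` is regular on `A/(a)`.
[cite: Matsumura1987, Thm. 16.2 (i)] -/
theorem isWeaklyRegular_pair_iff (a b : A) :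
    RingTheory.Sequence.IsWeaklyRegular A (List.ofFn (Fin.cons a fun _ : Fin 1 => b)) ↔
      IsSMulRegular A a ∧ IsSMulRegular (A ⧸ Ideal.span {a}) b := by
  rw [List.ofFn_succ, Fin.cons_zero, RingTheory.Sequence.isWeaklyRegular_cons_iff]
  simp only [Fin.cons_succ, List.ofFn_succ, List.ofFn_zero,
    RingTheory.Sequence.isWeaklyRegular_singleton_iff]
  have hK : (a • ⊤ : Submodule A A) = Ideal.span {a} := by
    rw [← Submodule.ideal_span_singleton_smul, smul_eq_mul, Ideal.mul_top]
  constructor <;> rintro ⟨h1, h2⟩ <;> refine ⟨h1, ?_⟩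
  · exact ((Submodule.quotEquivOfEq _ _ hK).isSMulRegular_congr b).mp h2
  · exact ((Submodule.quotEquivOfEq _ _ hK).isSMulRegular_congr b).mpr h2

/-- Regularity of `b` on `A/(a)`, in terms of ideals: `b y ∈ (a) ⇒ y ∈ (a)`. [folklore] -/
theorem isSMulRegular_quot_span_iff (a b : A) :
    IsSMulRegular (A ⧸ Ideal.span {a}) b ↔ ∀ y : A, b * y ∈ Ideal.span {a} → y ∈ Ideal.span {a} := by
  constructor
  · intro h y hy
    have h1 : b • Ideal.Quotient.mk (Ideal.span {a}) y = b • 0 := by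
      rw [smul_zero, Algebra.smul_def, Ideal.Quotient.algebraMap_eq, ← map_mul,
        Ideal.Quotient.eq_zero_iff_mem.mpr hy]
    exact Ideal.Quotient.eq_zero_iff_mem.mp (h h1)
  · intro h p q hpq
    obtain ⟨p, rfl⟩ := Ideal.Quotient.mk_surjective p
    obtain ⟨q, rfl⟩ := Ideal.Quotient.mk_surjective q
    have h1 : Ideal.Quotient.mk (Ideal.span {a}) (b * p) = Ideal.Quotient.mk (Ideal.span {a}) (b * q) := by
      rw [map_mul, map_mul]
      simpa only [Algebra.smul_def, Ideal.Quotient.algebraMap_eq] using hpq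
    rw [Ideal.Quotient.eq] at h1 ⊢
    exact h _ (by rw [mul_sub]; exact h1)

/-- **Perturbation**: regularity of `b` modulo `a` only depends on `b` mod `a`. [folklore] -/
theorem isSMulRegular_quot_span_congr (a b m : A) (h : IsSMulRegular (A ⧸ Ideal.span {a}) b) :
    IsSMulRegular (A ⧸ Ideal.span {a}) (b + a * m) := by
  rw [isSMulRegular_quot_span_iff] at h ⊢
  intro y hy
  refine h y ?_
  have h2 : (b + a * m) * y - a * (m * y) = b * y := by ring
  rw [← h2]
  exact Ideal.sub_mem _ hy (Ideal.mul_mem_right _ _ (Ideal.subset_span rfl))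

/-- **`[a, b]` weakly regular ⇒ `[a, b + a m]` weakly regular.** [cite: Matsumura1987, Thm. 16.2 (i)] -/
theorem isWeaklyRegular_pair_of_add_mul (a b m : A)
    (h : RingTheory.Sequence.IsWeaklyRegular A (List.ofFn (Fin.cons a fun _ : Fin 1 => b))) :
    RingTheory.Sequence.IsWeaklyRegular A (List.ofFn (Fin.cons a fun _ : Fin 1 => b + a * m)) := by
  rw [isWeaklyRegular_pair_iff] at h ⊢
  exact ⟨h.1, isSMulRegular_quot_span_congr a b m h.2⟩

/-- **Swap**: for non-zero-divisors `a, b`, if `b` is regular modulo `a` then `a` is regular modulo `b`.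
[folklore] -/
theorem isSMulRegular_quot_span_swap (a b : A) (ha : a ∈ nonZeroDivisors A)
    (h : IsSMulRegular (A ⧸ Ideal.span {a}) b) : IsSMulRegular (A ⧸ Ideal.span {b}) a := by
  rw [isSMulRegular_quot_span_iff] at h ⊢
  intro y hy
  obtain ⟨z, hz⟩ := Ideal.mem_span_singleton'.mp hy
  -- `z b = a y`, so `b z ∈ (a)`, so `z = a z'`, so `a y = a z' b`, so `y = z' b`
  have hbz : b * z ∈ Ideal.span {a} := Ideal.mem_span_singleton'.mpr ⟨y, by rw [mul_comm y a, ← hz, mul_comm]⟩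
  obtain ⟨z', hz'⟩ := Ideal.mem_span_singleton'.mp (h z hbz)
  refine Ideal.mem_span_singleton'.mpr ⟨z', ?_⟩
  have h1 : a * (z' * b) = a * y := by rw [← mul_assoc, mul_comm a z', hz', hz]
  exact (mul_cancel_left_mem_nonZeroDivisors ha).mp h1

/-- **`[a, b]` weakly regular with `a, b` non-zero-divisors ⇒ `[b, a]` weakly regular.**
[cite: Matsumura1987, Thm. 16.2 (i)] -/
theorem isWeaklyRegular_pair_swap (a b : A) (ha : a ∈ nonZeroDivisors A) (hb : b ∈ nonZeroDivisors A)
    (h : RingTheory.Sequence.IsWeaklyRegular A (List.ofFn (Fin.cons a fun _ : Fin 1 => b))) :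
    RingTheory.Sequence.IsWeaklyRegular A (List.ofFn (Fin.cons b fun _ : Fin 1 => a)) := by
  rw [isWeaklyRegular_pair_iff] at h ⊢
  exact ⟨Module.Flat.isSMulRegular_of_nonZeroDivisors hb, isSMulRegular_quot_span_swap a b ha h.2⟩

/-- Quasi-regular version of the swap. [cite: Matsumura1987, Thm. 16.2 (i)] -/
theorem isQuasiRegular_pair_swap (a b : A) (ha : a ∈ nonZeroDivisors A) (hb : b ∈ nonZeroDivisors A)
    (h : RingTheory.Sequence.IsWeaklyRegular A (List.ofFn (Fin.cons a fun _ : Fin 1 => b))) :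
    IsQuasiRegular (Fin.cons b (fun _ : Fin 1 => a) : Fin 2 → A) :=
  isQuasiRegular_of_isWeaklyRegular _ (isWeaklyRegular_pair_swap a b ha hb h)

/-- Quasi-regular version of the perturbation. [cite: Matsumura1987, Thm. 16.2 (i)] -/
theorem isQuasiRegular_pair_of_add_mul (a b m : A)
    (h : RingTheory.Sequence.IsWeaklyRegular A (List.ofFn (Fin.cons a fun _ : Fin 1 => b))) :
    IsQuasiRegular (Fin.cons a (fun _ : Fin 1 => b + a * m) : Fin 2 → A) :=
  isQuasiRegular_of_isWeaklyRegular _ (isWeaklyRegular_pair_of_add_mul a b m h)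

end ConeRung

end Summit.ResolutionOfSingularities.ResolutionOfSingularities.Theorems

end
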